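import Mathlib
import Summits.MatrixMultiplication.Statement
import Summits.MatrixMultiplication.MatrixMultiplication.Theorems.GraphEquationsCubicSpecimenOrders

/-!
# Kernel towers in set form and the tower-height dial (`GraphEquations`, kernel M79)

Decomp-mm node «GraphEquations» (lens 5: base range + asymptotic regime + bridge); attacked leaf
`MultiplicityReduction` (stmt-MatrixMultiplication-27806); target of the node, VERBATIM:
`_root_.MatrixMultiplication`.  The route cut `closes (hV : GraphEquationsQuadratic)
(hM : MultiplicityReduction)` is untouched; everything here sits under `hM` via the degree ladder
(M70) and the kernel-field currency (M76–M78).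

## 1. The tower predicate (critic g44 → g45, ask 1), SET form

A KERNEL TOWER over a set `S ⊆ ℂ[A,B,C]` along coefficient fields `μ₁, …, μ_r` is the chain
`S₀ = S`, `S_{i+1} = S_i ∪ D_{μ_{i+1}} S_i` with `μ_{i+1}` a KERNEL FIELD of `S_i`
(`D_{μ_{i+1}} S_i ⊆ I(Γ)`): `towerSet S μs` is the last stage, `IsKernelTower S μs` the kernel
conditions.  This is the canonical form: `EqSystem.forall_chainDeflatesTo_idealInitIsolatedAt_iff`
— "every system reached from `E` by a chain of deflations along `μs` is ideal-initially-isolated to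
order `K` over `y`" says exactly `IdealInitIsolatedSet (towerSet T(E) μs) K y` (exact realisations,
`EqSystem.exists_exact_deflation`, generalising M76 `forall_deflatesTo_idealInitIsolatedAt_iff`).

## 2. The dial `TowerReach D r K` (cost-free; quantifier `∀ n ≥ 1`)

`TowerReach D r K`: for ALL `n ≥ 1`, every CORRECT system with tests of degree `≤ D` admits a kernel
tower of height `≤ r` whose last stage is ideal-initially-isolated to order `K` over SOME base pair.
No cost is charged (the fields need not be exposed by a program): it is the GEOMETRIC shadow of the
kernel-field dials, `TowerReach D 0 K ↔ DegreeBoundsIsoOrder D K` (`towerReach_zero_iff`) and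
`KernelFieldClauseDeg D K → TowerReach D 1 K` (`towerReach_one_of_kernelFieldClauseDeg`).
Every refutation below holds at one fixed `n` (`n = 2`, resp. `n = 1`) and hence under either
reading of the quantifier (`∀ n ≥ 1` or "for all large `n`": the specimens embed in every `n² ≥ 2`,
resp. every `n ≥ 1`).

* `not_towerReach_four_one_one : ¬ TowerReach 4 1 1` (the cubic specimen, M78a);
* `not_towerReach_pow : r + K + 1 ≤ e → ¬ TowerReach (2e) r K` (power systems `{f_q^e}`: ANY tower of
  height `r` lands in `I^(e-r)`, `towerSet_subset_pow`, and `I^(K+1)` isolates to no order `≤ K`, M13) —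
  so the minimal height at degree `D` for order `1` is at least `D/2 - 1`, unbounded in `D`;
* `cubic_tower_height_two`: on the cubic specimen the kernel-tower height for order `1` is EXACTLY `2`
  over every base pair (`≥ 2`: M78a in set form; `≤ 2`: the tower `v, v`, `D_v D_v t₁ = 6 f_{p₁}`, M78b).

## 3. Which way the height question went (ask 1: «say which»)

We hunted the THEOREM, not a height-`3` specimen, and the answer (paper, memo NODE-g45 §3) is:
**`TowerReach 4 2 1` holds — at degree `4` a kernel tower of height `≤ 2` along two generic
syzygy-valued fields reaches order `1` over a generic base pair, for every correct system.**  Sketch: a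
degree-`≤ 4` member of `I(Γ)` has `F`-degree `≤ 3` with CONSTANT cubic coefficients; round one along a
generic field `μ` with `L μ = 0` adds the polarised quadratic parts `b_Q(μ(y), ·)`, round two along a
generic `μ'` with `L μ' = 0`, `b_Q(μ, μ') = 0` adds `b_Q(μ'(y), ·)` and the polarised cubic parts
`c_N(μ(y), μ'(y), ·)`; a Jacobian-rank count on the incidence variety of bad directions (the cubic
parts are base-point-free on the zero cone of the quadratic parts, by correctness over `y`) shows that
a generic pair finishes.  This is NOT claimed in Lean (it needs the Jacobian criterion and graded
Noether normalisation over `ℂ`); `cubic_tower_height_two` shows the bound `2` is attained, so the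
degree-`4` tower height for order `1` is EXACTLY `2`.  Consequence (memo): the geometry of degree-`4`
deflation is generic, and the whole content of the degree-`4` rung of `hM` is the COST of exposing two
generic syzygy-valued fields of the linear-part matrix (division-free: maximal minors) — no
`KernelFieldClauseDeg` variant is filed (ask 3).

No `sorry`.  Sources: Leykin–Verschelde–Zhao, *Newton's method with deflation for isolated
singularities of polynomial systems*, TCS 359 (2006) 111–122 [doi:10.1016/j.tcs.2006.02.018], Thm 3.1
and §4 (iterated deflation; the number of rounds); [BurgisserClausenShokrollahi1997, §7.1, Problem 16.3].
-/

set_option linter.dupNamespace false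

noncomputable section
open scoped BigOperators

namespace Summit.MatrixMultiplication.MatrixMultiplication.Theorems.GraphEquations

open MvPolynomial Matrix Literature.Computability.AlgebraicComplexity
open Literature.Computability.AlgebraicComplexity.ArithCircuit

variable {n : ℕ}

/-! ## Kernel towers in set form -/

/-- The generating set reached by the tower of deflations along the fields `μs` (in order):
`towerSet S [] = S`, `towerSet S (μ :: μs) = towerSet (S ∪ D_μ S) μs`. -/
def towerSet : Set (MvPolynomial (GraphVars n) ℂ) →
    List (Fin n × Fin n → MvPolynomial (MatMulVars n) ℂ) → Set (MvPolynomial (GraphVars n) ℂ)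
  | S, [] => S
  | S, μ :: μs => towerSet (S ∪ derivC μ '' S) μs

/-- KERNEL TOWER over `S` along `μs`: each field is a kernel field of the stage reached before it
(`D_{μ_{i+1}} S_i ⊆ I(Γ)`). -/
def IsKernelTower : Set (MvPolynomial (GraphVars n) ℂ) →
    List (Fin n × Fin n → MvPolynomial (MatMulVars n) ℂ) → Prop
  | _, [] => True
  | S, μ :: μs => (∀ t ∈ S, derivC μ t ∈ graphIdeal n) ∧ IsKernelTower (S ∪ derivC μ '' S) μs

/-- Height `0`: the set itself. -/
@[simp] theorem towerSet_nil (S : Set (MvPolynomial (GraphVars n) ℂ)) : towerSet S [] = S := rfl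

/-- One more field: pass to `S ∪ D_μ S`. -/
@[simp] theorem towerSet_cons (S : Set (MvPolynomial (GraphVars n) ℂ))
    (μ : Fin n × Fin n → MvPolynomial (MatMulVars n) ℂ) (μs : List (Fin n × Fin n → MvPolynomial (MatMulVars n) ℂ)) :
    towerSet S (μ :: μs) = towerSet (S ∪ derivC μ '' S) μs := rfl

/-- The empty tower is a kernel tower. -/
@[simp] theorem isKernelTower_nil (S : Set (MvPolynomial (GraphVars n) ℂ)) : IsKernelTower S [] := trivial

/-- The kernel conditions of a tower `μ :: μs`. -/
theorem isKernelTower_cons_iff (S : Set (MvPolynomial (GraphVars n) ℂ))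
    (μ : Fin n × Fin n → MvPolynomial (MatMulVars n) ℂ) (μs : List (Fin n × Fin n → MvPolynomial (MatMulVars n) ℂ)) :
    IsKernelTower S (μ :: μs) ↔ (∀ t ∈ S, derivC μ t ∈ graphIdeal n) ∧ IsKernelTower (S ∪ derivC μ '' S) μs :=
  Iff.rfl

/-- Monotone in the generating set. -/
theorem towerSet_mono {S S' : Set (MvPolynomial (GraphVars n) ℂ)} (h : S ⊆ S') :
    ∀ μs : List (Fin n × Fin n → MvPolynomial (MatMulVars n) ℂ), towerSet S μs ⊆ towerSet S' μs
  | [] => h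
  | _ :: μs => towerSet_mono (Set.union_subset_union h (Set.image_mono h)) μs

/-- A kernel tower over a subset of `I(Γ)` stays inside `I(Γ)`. -/
theorem towerSet_subset_graphIdeal {S : Set (MvPolynomial (GraphVars n) ℂ)}
    {μs : List (Fin n × Fin n → MvPolynomial (MatMulVars n) ℂ)}
    (hS : S ⊆ (graphIdeal n : Set (MvPolynomial (GraphVars n) ℂ))) (hT : IsKernelTower S μs) :
    towerSet S μs ⊆ (graphIdeal n : Set (MvPolynomial (GraphVars n) ℂ)) := by
  induction μs generalizing S with
  | nil => exact hS
  | cons μ μs ih =>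
    rw [towerSet_cons]
    refine ih (Set.union_subset hS ?_) hT.2
    rintro _ ⟨t, ht, rfl⟩
    exact hT.1 t ht

/-- **Towers lower `J`-adic depth by at most their height, for ANY fields**: `S ⊆ J^(d + |μs|)` gives
`towerSet S μs ⊆ J^d` (Leibniz rule, `derivC_mem_pow_of_mem_pow_succ`). -/
theorem towerSet_subset_pow (J : Ideal (MvPolynomial (GraphVars n) ℂ)) {S : Set (MvPolynomial (GraphVars n) ℂ)} :
    ∀ (μs : List (Fin n × Fin n → MvPolynomial (MatMulVars n) ℂ)) (d : ℕ),
      S ⊆ ((J ^ (d + μs.length) : Ideal _) : Set (MvPolynomial (GraphVars n) ℂ)) →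
        towerSet S μs ⊆ ((J ^ d : Ideal _) : Set (MvPolynomial (GraphVars n) ℂ))
  | [], d, hS => by simpa using hS
  | μ :: μs, d, hS => by
    refine towerSet_subset_pow J μs d (Set.union_subset (fun s hs => ?_) ?_)
    · exact Ideal.pow_le_pow_right (by rw [List.length_cons]; omega) (hS hs)
    · rintro _ ⟨s, hs, rfl⟩
      exact derivC_mem_pow_of_mem_pow_succ μ J (d + μs.length) (hS hs)

/-- Order monotonicity for sets (the system version is M76 `IdealInitIsolatedAt.mono_order`). -/
theorem IdealInitIsolatedSet.mono_order {S : Set (MvPolynomial (GraphVars n) ℂ)} {K K' : ℕ}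
    {y : MatMulVars n → ℂ} (h : IdealInitIsolatedSet S K y) (hKK' : K ≤ K') : IdealInitIsolatedSet S K' y := by
  obtain ⟨T, u, hu, ν, G, hν, hG, hlow, hiso⟩ := h
  exact ⟨T, u, hu, ν, G, fun o => (hν o).trans hKK', hG, hlow, hiso⟩

/-! ## Systems: exact deflations, chains, and the canonical form -/

namespace EqSystem

/-- Kernel fields of a system, set form versus test indices. -/
theorem kernel_testSet_iff (E : EqSystem n) (μ : Fin n × Fin n → MvPolynomial (MatMulVars n) ℂ) :
    (∀ t ∈ E.testSet, derivC μ t ∈ graphIdeal n) ↔ ∀ j ∈ E.tests, derivC μ (E.testPoly j) ∈ graphIdeal n := by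
  constructor
  · intro h j hj
    exact h _ ((E.mem_testSet_iff _).2 ⟨j, hj, rfl⟩)
  · intro h t ht
    obtain ⟨j, hj, rfl⟩ := (E.mem_testSet_iff t).1 ht
    exact h j hj

/-- **EXACT DEFLATION**: a fan-in-two system whose test set is exactly `T(E) ∪ D_μ T(E)`. -/
theorem exists_exact_deflation (E : EqSystem n) (μ : Fin n × Fin n → MvPolynomial (MatMulVars n) ℂ) :
    ∃ E' : EqSystem n, E'.circuit.IsFanInTwo ∧ E.DeflatesTo μ E' ∧
      E'.testSet = E.testSet ∪ derivC μ '' E.testSet := by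
  classical
  obtain ⟨E', hfan, hto, hfrom⟩ :=
    exists_realisation_list (E.tests.map E.testPoly ++ E.tests.map fun j => derivC μ (E.testPoly j))
  refine ⟨E', hfan, ⟨fun j hj => hfrom _ (List.mem_append_left _ (List.mem_map.2 ⟨j, hj, rfl⟩)),
    fun j hj => hfrom _ (List.mem_append_right _ (List.mem_map.2 ⟨j, hj, rfl⟩))⟩, Set.ext fun t => ?_⟩
  rw [E'.mem_testSet_iff]
  constructor
  · rintro ⟨j', hj', rfl⟩
    rcases List.mem_append.1 (hto j' hj') with hm | hm
    · obtain ⟨j, hj, he⟩ := List.mem_map.1 hm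
      exact Or.inl ((E.mem_testSet_iff _).2 ⟨j, hj, he⟩)
    · obtain ⟨j, hj, he⟩ := List.mem_map.1 hm
      exact Or.inr ⟨E.testPoly j, (E.mem_testSet_iff _).2 ⟨j, hj, rfl⟩, he⟩
  · rintro (ht | ⟨s, hs, rfl⟩)
    · obtain ⟨j, hj, rfl⟩ := (E.mem_testSet_iff t).1 ht
      exact hfrom _ (List.mem_append_left _ (List.mem_map.2 ⟨j, hj, rfl⟩))
    · obtain ⟨j, hj, rfl⟩ := (E.mem_testSet_iff s).1 hs
      exact hfrom _ (List.mem_append_right _ (List.mem_map.2 ⟨j, hj, rfl⟩))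

/-- `E'` is reached from `E` by a CHAIN OF DEFLATIONS along `μs`: systems `E = E₀, E₁, …, E_r = E'`,
each containing the deflation of the previous one along the next field. -/
def ChainDeflatesTo : EqSystem n → List (Fin n × Fin n → MvPolynomial (MatMulVars n) ℂ) → EqSystem n → Prop
  | E, [], E' => E' = E
  | E, μ :: μs, E'' => ∃ E' : EqSystem n, E.DeflatesTo μ E' ∧ ChainDeflatesTo E' μs E''

/-- The empty chain. -/
@[simp] theorem chainDeflatesTo_nil {E E' : EqSystem n} : ChainDeflatesTo E [] E' ↔ E' = E := Iff.rfl

/-- One link. -/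
theorem chainDeflatesTo_cons_iff {E E'' : EqSystem n} {μ : Fin n × Fin n → MvPolynomial (MatMulVars n) ℂ}
    {μs : List (Fin n × Fin n → MvPolynomial (MatMulVars n) ℂ)} :
    ChainDeflatesTo E (μ :: μs) E'' ↔ ∃ E' : EqSystem n, E.DeflatesTo μ E' ∧ ChainDeflatesTo E' μs E'' :=
  Iff.rfl

/-- **EXACT TOWERS**: a chain of deflations along `μs` ending in a system whose test set is exactly
`towerSet T(E) μs`. -/
theorem exists_exact_tower (E : EqSystem n) :
    ∀ μs : List (Fin n × Fin n → MvPolynomial (MatMulVars n) ℂ),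
      ∃ E' : EqSystem n, ChainDeflatesTo E μs E' ∧ E'.testSet = towerSet E.testSet μs
  | [] => ⟨E, rfl, rfl⟩
  | μ :: μs => by
    obtain ⟨E₁, -, hD, hT⟩ := E.exists_exact_deflation μ
    obtain ⟨E', hC, hT'⟩ := exists_exact_tower E₁ μs
    exact ⟨E', ⟨E₁, hD, hC⟩, by rw [hT', hT, towerSet_cons]⟩

/-- A chain along `μs` reaches a system containing `towerSet T(E) μs`. -/
theorem ChainDeflatesTo.towerSet_subset {E E' : EqSystem n}
    {μs : List (Fin n × Fin n → MvPolynomial (MatMulVars n) ℂ)} (h : ChainDeflatesTo E μs E') :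
    towerSet E.testSet μs ⊆ E'.testSet := by
  induction μs generalizing E with
  | nil =>
    rw [chainDeflatesTo_nil] at h
    subst h
    exact subset_rfl
  | cons μ μs ih =>
    obtain ⟨E₁, hD, hC⟩ := h
    refine (towerSet_mono (Set.union_subset hD.testSet_subset ?_) μs).trans (ih hC)
    rintro _ ⟨s, hs, rfl⟩
    exact hD.derivC_mem_testSet s hs

/-- **THE TOWER CLAUSE IS CANONICAL.**  "Every system reached from `E` by a chain of deflations along
`μs` is ideal-initially-isolated to order `K` over `y`" says exactly that `span (towerSet T(E) μs)` is
initially isolated to order `K` over `y` (generalises M76 `forall_deflatesTo_idealInitIsolatedAt_iff`). -/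
theorem forall_chainDeflatesTo_idealInitIsolatedAt_iff (E : EqSystem n)
    (μs : List (Fin n × Fin n → MvPolynomial (MatMulVars n) ℂ)) (K : ℕ) (y : MatMulVars n → ℂ) :
    (∀ E' : EqSystem n, ChainDeflatesTo E μs E' → E'.IdealInitIsolatedAt K y) ↔
      IdealInitIsolatedSet (towerSet E.testSet μs) K y := by
  constructor
  · intro h
    obtain ⟨E', hC, hT⟩ := E.exists_exact_tower μs
    rw [← hT]
    exact (E'.idealInitIsolatedAt_iff K y).1 (h E' hC)
  · intro h E' hC
    exact (E'.idealInitIsolatedAt_iff K y).2 (h.mono (Ideal.span_mono hC.towerSet_subset))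

end EqSystem

/-! ## The tower-height dial -/

/-- **`TowerReach D r K`** (cost-free; quantifier `∀ n ≥ 1`): every CORRECT system over `n ≥ 1` with
tests of degree `≤ D` admits a KERNEL TOWER of height `≤ r` over its test set whose last stage is
ideal-initially-isolated to order `K` over SOME base pair.  The refutations in this file hold at a
fixed `n` (`2`, resp. `1`) and embed in every larger `n`, so they do not depend on reading the
quantifier as `∀ n ≥ 1` rather than "for all large `n`". -/
def TowerReach (D r K : ℕ) : Prop :=
  ∀ n : ℕ, 1 ≤ n → ∀ E : EqSystem n, E.Correct → E.IsDegLe D →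
    ∃ μs : List (Fin n × Fin n → MvPolynomial (MatMulVars n) ℂ), μs.length ≤ r ∧
      IsKernelTower E.testSet μs ∧ ∃ y, IdealInitIsolatedSet (towerSet E.testSet μs) K y

/-- Monotone in the height. -/
theorem TowerReach.mono_height {D r r' K : ℕ} (h : TowerReach D r K) (hrr' : r ≤ r') : TowerReach D r' K :=
  fun n hn E hE hD => by
    obtain ⟨μs, hlen, hT, hiso⟩ := h n hn E hE hD
    exact ⟨μs, hlen.trans hrr', hT, hiso⟩

/-- Monotone in the target order. -/
theorem TowerReach.mono_order {D r K K' : ℕ} (h : TowerReach D r K) (hKK' : K ≤ K') : TowerReach D r K' :=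
  fun n hn E hE hD => by
    obtain ⟨μs, hlen, hT, hiso⟩ := h n hn E hE hD
    exact ⟨μs, hlen, hT, hiso.imp fun y hy => hy.mono_order hKK'⟩

/-- Antitone in the degree. -/
theorem TowerReach.anti_deg {D D' r K : ℕ} (h : TowerReach D' r K) (hDD' : D ≤ D') : TowerReach D r K :=
  fun n hn E hE hD => h n hn E hE (hD.mono hDD')

/-- **Height `0` is the order dial**: `TowerReach D 0 K ↔ DegreeBoundsIsoOrder D K` (M71). -/
theorem towerReach_zero_iff {D K : ℕ} : TowerReach D 0 K ↔ DegreeBoundsIsoOrder D K := by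
  constructor
  · intro h n hn E hE hD
    obtain ⟨μs, hlen, -, y, hy⟩ := h n hn E hE hD
    obtain rfl : μs = [] := List.eq_nil_of_length_eq_zero (Nat.le_zero.1 hlen)
    exact ⟨y, (E.idealInitIsolatedAt_iff K y).2 hy⟩
  · intro h n hn E hE hD
    obtain ⟨y, hy⟩ := h n hn E hE hD
    exact ⟨[], le_rfl, trivial, y, (E.idealInitIsolatedAt_iff K y).1 hy⟩

/-- **Height `1` is the cost-free shadow of the one-round kernel-field dial** (M76):
`KernelFieldClauseDeg D K → TowerReach D 1 K`. -/
theorem towerReach_one_of_kernelFieldClauseDeg {D K : ℕ} (h : KernelFieldClauseDeg D K) : TowerReach D 1 K := by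
  obtain ⟨c, hc⟩ := h
  intro n hn E hE hD
  obtain ⟨μ, Eμ, -, -, hKF, -, hgood⟩ := hc n hn E hE hD
  obtain ⟨E', -, hD', hT⟩ := E.exists_exact_deflation μ
  obtain ⟨y, hy⟩ := hgood E' hD'
  refine ⟨[μ], le_rfl, ⟨(E.kernel_testSet_iff μ).2 hKF, trivial⟩, y, ?_⟩
  rw [towerSet_cons, towerSet_nil, ← hT]
  exact (E'.idealInitIsolatedAt_iff K y).1 hy

/-- **`¬ TowerReach 4 1 1`**: at degree `4` no kernel tower of height `≤ 1` reaches order `1` on the cubic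
specimen over `n = 2` (M78a in set form; height `0` fails by its masking certificate). -/
theorem not_towerReach_four_one_one : ¬ TowerReach 4 1 1 := by
  intro h
  obtain ⟨E, hE, hdeg, hto, hfrom, hmask, -⟩ := exists_cubicSystem (n := 2) (by norm_num)
  obtain ⟨μs, hlen, hT, y, hy⟩ := h 2 (by norm_num) E hE hdeg
  rcases μs with _ | ⟨μ, _ | ⟨ν, rest⟩⟩
  · exact hmask 1 (by norm_num) y ((E.idealInitIsolatedAt_iff 1 y).2 hy)
  · obtain ⟨hker, -⟩ := hT
    exact cubic_one_round_not_order_one_set (by norm_num) hto hfrom μ ((E.kernel_testSet_iff μ).1 hker) y hy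
  · simp at hlen

/-- **Deep systems, any `n ≥ 1`**: if the tests of `E` lie in `I^e`, then NO tower of height `r` with
`K + r < e` over `T(E)` — kernel tower or not — is initially isolated to order `K` over any base pair:
it lands in `I^(e-r)` (`towerSet_subset_pow`), and `I^(K+1)` isolates to no order `≤ K` (M13). -/
theorem not_idealInitIsolatedSet_towerSet_of_tests_mem_pow (hn : 1 ≤ n) {E : EqSystem n} {K e : ℕ}
    (μs : List (Fin n × Fin n → MvPolynomial (MatMulVars n) ℂ)) (hK : K + μs.length < e)
    (hpow : ∀ j ∈ E.tests, E.testPoly j ∈ graphIdeal n ^ e) (y : MatMulVars n → ℂ) :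
    ¬ IdealInitIsolatedSet (towerSet E.testSet μs) K y := by
  rintro ⟨T, u, hu, hiso⟩
  have hS : E.testSet ⊆ ((graphIdeal n ^ ((e - μs.length) + μs.length) : Ideal _) :
      Set (MvPolynomial (GraphVars n) ℂ)) := by
    intro t ht
    obtain ⟨j, hj, rfl⟩ := (E.mem_testSet_iff t).1 ht
    rw [Nat.sub_add_cancel (by omega)]
    exact hpow j hj
  have hle : Ideal.span (towerSet E.testSet μs) ≤ graphIdeal n ^ (e - μs.length) :=
    Ideal.span_le.2 (towerSet_subset_pow _ μs _ hS)
  exact not_initIsolatedFam_of_mem_pow hn (show K < e - μs.length by omega) (fun i => hle (hu i)) y hiso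

/-- **POWER SYSTEMS BOUND THE HEIGHT FROM BELOW, linearly in the degree**: for `r + K + 1 ≤ e`,
`¬ TowerReach (2e) r K` (the power system `{f_q^e}`, degree `2e`, over `n = 1`; the same specimen lives
over every `n ≥ 1`).  In particular order `1` from degree `D` needs height `≥ ⌈D/2⌉ - 1`. -/
theorem not_towerReach_pow {r K e : ℕ} (hrK : r + K + 1 ≤ e) : ¬ TowerReach (2 * e) r K := by
  intro hT
  obtain ⟨E, hE, hdeg, hpow⟩ := exists_powerSystem (n := 1) (e := e) (by omega)
  obtain ⟨μs, hlen, -, y, hy⟩ := hT 1 le_rfl E hE hdeg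
  exact not_idealInitIsolatedSet_towerSet_of_tests_mem_pow le_rfl μs (by omega) hpow y hy

/-- `K = 1`: height `1` is impossible from degree `6` on, height `2` from degree `8` on. -/
theorem not_towerReach_six_one_one : ¬ TowerReach 6 1 1 ∧ ¬ TowerReach 8 2 1 :=
  ⟨not_towerReach_pow (r := 1) (K := 1) (e := 3) le_rfl, not_towerReach_pow (r := 2) (K := 1) (e := 4) le_rfl⟩

/-! ## The cubic specimen has kernel-tower height exactly two -/

/-- Second derivatives of the cubic tests along `v` stay in `I(Γ)`:
`D_v D_v t₁ = 6 f_{p₁}`, `D_v D_v t₀ = 0`, `D_v D_v t_i = 0`. -/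
theorem cubicDir_kernel_two (h2 : 2 ≤ n * n) (i : Fin (n * n)) :
    derivC (cubicDir h2) (derivC (cubicDir h2) (cubicTest h2 i)) ∈ graphIdeal n := by
  classical
  rw [← substF_cubicG, ← substF_polarDeriv, ← substF_polarDeriv, substF_mem_graphIdeal_iff]
  have i0lt : 0 < n * n := by omega
  have i1lt : 1 < n * n := by omega
  by_cases h1 : i = ⟨1, i1lt⟩
  · subst h1
    rw [polarDeriv_polarDeriv_cubicDir_cubicG_one]
    simp [constantCoeff_X]
  by_cases h0 : i = ⟨0, i0lt⟩
  · subst h0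
    rw [(polarDeriv_cubicDir_cubicG h2).2, polarDeriv_zero, map_zero]
  · have hG : cubicG h2 i = X (chainPos n i) := by
      unfold cubicG
      rw [if_neg (fun h => h0 (Fin.ext h)), if_neg (fun h => h1 (Fin.ext h))]
    rw [hG, polarDeriv_X, cubicDir_chainPos, if_neg (fun h => h0 (Fin.ext h)), if_neg (fun h => h1 (Fin.ext h)),
      polarDeriv_C, map_zero]

/-- **THE CUBIC SPECIMEN HAS KERNEL-TOWER HEIGHT EXACTLY TWO (order `1`, `n² ≥ 2`).**  A CORRECT
degree-`4` system `E` such that (a) NO kernel tower of height `≤ 1` over `T(E)` reaches order `1` over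
any base pair, while (b) the tower `v, v` along the base-quadratic field `v = (α, −1, 0, …)` IS a kernel
tower and (c) its last stage `T(E) ∪ D_v T(E) ∪ D_v(T(E) ∪ D_v T(E)) ∋ 6 f_{p₁}` is initially isolated to
order `1` over EVERY base pair. -/
theorem cubic_tower_height_two (h2 : 2 ≤ n * n) :
    ∃ E : EqSystem n, E.Correct ∧ E.IsDegLe 4 ∧
      (∀ μs : List (Fin n × Fin n → MvPolynomial (MatMulVars n) ℂ), μs.length ≤ 1 →
        IsKernelTower E.testSet μs → ∀ y, ¬ IdealInitIsolatedSet (towerSet E.testSet μs) 1 y) ∧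
      IsKernelTower E.testSet [cubicDir h2, cubicDir h2] ∧
      ∀ y, IdealInitIsolatedSet (towerSet E.testSet [cubicDir h2, cubicDir h2]) 1 y := by
  obtain ⟨E, hE, hdeg, hto, hfrom, hmask, -⟩ := exists_cubicSystem h2
  -- kernel conditions, on tests
  have hk1 : ∀ t ∈ E.testSet, derivC (cubicDir h2) t ∈ graphIdeal n := fun t ht => by
    obtain ⟨j, hj, rfl⟩ := (E.mem_testSet_iff t).1 ht
    obtain ⟨i, hi⟩ := hto j hj
    rw [hi]; exact cubicDir_kernel h2 i
  have hk2 : ∀ t ∈ E.testSet ∪ derivC (cubicDir h2) '' E.testSet,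
      derivC (cubicDir h2) t ∈ graphIdeal n := by
    rintro t (ht | ⟨s, hs, rfl⟩)
    · exact hk1 t ht
    · obtain ⟨j, hj, rfl⟩ := (E.mem_testSet_iff s).1 hs
      obtain ⟨i, hi⟩ := hto j hj
      rw [hi]; exact cubicDir_kernel_two h2 i
  refine ⟨E, hE, hdeg, fun μs hlen hT y hy => ?_, ⟨hk1, hk2, trivial⟩, fun y => ?_⟩
  · rcases μs with _ | ⟨μ, _ | ⟨ν, rest⟩⟩
    · exact hmask 1 (by norm_num) y ((E.idealInitIsolatedAt_iff 1 y).2 hy)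
    · exact cubic_one_round_not_order_one_set h2 hto hfrom μ ((E.kernel_testSet_iff μ).1 hT.1) y hy
    · simp at hlen
  · -- two exact rounds along `v`, then M78b `cubic_two_rounds_order_one`
    obtain ⟨E', -, hD, hT'⟩ := E.exists_exact_deflation (cubicDir h2)
    obtain ⟨E'', -, hD', hT''⟩ := E'.exists_exact_deflation (cubicDir h2)
    have h := (E''.idealInitIsolatedAt_iff 1 y).1 (cubic_two_rounds_order_one h2 hfrom hD hD' y)
    rwa [hT'', hT'] at h

end Summit.MatrixMultiplication.MatrixMultiplication.Theorems.GraphEquations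

end
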